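import Mathlib
import Summits.NavierStokesRegularity.NavierStokesRegularity.Theorems.ThreadingFluxHorizonTowerDefs
import Summits.NavierStokesRegularity.NavierStokesRegularity.Theorems.ThreadingFluxHorizonTowerOrderOneSphereEuler
import Summits.NavierStokesRegularity.NavierStokesRegularity.Theorems.ThreadingFluxHorizonTowerProfileFormulas
import Summits.NavierStokesRegularity.NavierStokesRegularity.Theorems.ThreadingFluxHorizonTowerProfileCore
import Summits.NavierStokesRegularity.NavierStokesRegularity.Theorems.ThreadingFluxHorizonTowerL2ClosedForm
import Summits.NavierStokesRegularity.NavierStokesRegularity.Theorems.ThreadingFluxHorizonTowerPoloidalFieldCalculus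
import Literature.Analysis.FluidPDE.VorticityCalculus
import Literature.Analysis.FluidPDE.NewtonKernel
import HarnessLib

/-!
# Crux `PoloidalLiouville` (stmt-NavierStokesRegularity-1222), crux idea «horizon-threading-tower» (ns-idea-15):
# STREAM-FUNCTION PROFILES — every smooth stream function on the sphere is an admissible scale-free profile,
# and its order-one horizon law is the sphere bracket (ORDER ONE = STATIONARY 2D EULER, both directions)

Support file (`--supports stmt-NavierStokesRegularity-1222`, helper; cell `ns-wall-extremal`, width hand ns-wall-eng-3 g3; 0 kit;
director key 04:06:45Z (b)).

`OrderOneSphereEuler` (theorem `orderOneSphereEuler`) goes from an admissible profile `U` (smooth off the centre, degree-0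
homogeneous, divergence free, unthreaded) to the bracket: `𝔏₁[U] = −r⟪y, ∇f × ∇Φ⟫`.  This file supplies the CONVERSE
REALISATION: for EVERY `Φ` smooth off the origin and degree-0 homogeneous, the field

  `U_Φ(z) = (−½ ‖z‖ ΔΦ(z)) · z + ‖z‖ · ∇Φ(z)`   (radial part `f_Φ = −½ r² ΔΦ`, so `r² ΔΦ = −2 f_Φ`)

is smooth off the origin, degree-0 homogeneous (`streamProfile_smul`), divergence free (`divergence_streamProfile`) and unthreaded
(`inner_curl_streamProfile`), with radial part `⟪U_Φ(z), z⟫/‖z‖ = f_Φ(z)` — hence (★ `horizonL1_streamProfile`)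
`𝔏₁[U_Φ](x) = −‖x‖ ⟪x, ∇f_Φ(x) × ∇Φ(x)⟫`.  READING: the order-one horizon law of scale-free profiles is EXACTLY the stationary
2D Euler equation `{Δ_S Φ, Φ} = 0` for stream functions on the sphere; since smooth non-zonal stationary Euler flows on S² exist
(e.g. non-axially symmetric solutions of the mean-field equation `Δu + ρ(eᵘ/∫eᵘ − 1/4π) = 0`, Gui–Hu 2019), the conjecture
`HorizonTowerZonality` genuinely needs its order-two hypothesis `𝔏₂ ≡ 0`; finite towers (`horizonL1_finiteTower`,
`twoShellHorizonTowerZonality`) are the sub-case where order one can suffice.  Ingredients: the scaling law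
`ΔΦ(c z) = c⁻² ΔΦ(z)` (`laplacian_smul_of_zeroHomogeneous`), smoothness of `ΔΦ` off the origin
(`contDiffAt_laplacian_of_contDiffOn`), the divergence / curl Leibniz rules of the tree (`divergence_smul_apply`,
`PoloidalField.curl_smul_self`, `OrderTwo.curl_smul_gradient`).

HONEST LABEL: vector calculus about one crux idea's typed objects; no sketch Prop is closed; `HorizonTowerZonality`,
`PoloidalLiouville` (1222) OPEN; NS regularity NOT proved.
-/

-- the summit and its single sub-problem share the name (CONVENTIONS §1)
set_option linter.dupNamespace false

noncomputable section

namespace Summit.NavierStokesRegularity.NavierStokesRegularity.Theorems.PoloidalLiouville.HorizonTower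

open Set Function Filter Topology Metric
open scoped Topology RealInnerProductSpace Laplacian ContDiff
open Literature.Analysis.FluidPDE

section StreamProfile

variable {Φ : E3 → ℝ}

/-- **Derivative scaling for a degree-(−1) homogeneous field**: `W(c z) = c⁻¹ W(z)` near `y`, `c ≠ 0` ⇒
`DW(c y) = c⁻² DW(y)`. -/
theorem fderiv_smul_of_invHomogeneous {W : E3 → E3} {y : E3} {c : ℝ} (hc : c ≠ 0)
    (hWy : DifferentiableAt ℝ W y) (hWc : DifferentiableAt ℝ W (c • y))
    (hhom : ∀ᶠ z in 𝓝 y, W (c • z) = c⁻¹ • W z) :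
    fderiv ℝ W (c • y) = (c⁻¹ * c⁻¹) • fderiv ℝ W y := by
  have hL : HasFDerivAt (fun z : E3 => c • z) (c • ContinuousLinearMap.id ℝ E3) y :=
    (hasFDerivAt_id y).const_smul c
  have h1 : HasFDerivAt (fun z => W (c • z)) ((fderiv ℝ W (c • y)).comp (c • ContinuousLinearMap.id ℝ E3)) y :=
    hWc.hasFDerivAt.comp y hL
  have h2 : HasFDerivAt (fun z => W (c • z)) (c⁻¹ • fderiv ℝ W y) y :=
    (hWy.hasFDerivAt.const_smul c⁻¹).congr_of_eventuallyEq hhom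
  have h3 : (fderiv ℝ W (c • y)).comp (c • ContinuousLinearMap.id ℝ E3) = c⁻¹ • fderiv ℝ W y := h1.unique h2
  have h4 : c • fderiv ℝ W (c • y) = c⁻¹ • fderiv ℝ W y := by
    rw [← h3]; ext v; simp
  have h5 : fderiv ℝ W (c • y) = c⁻¹ • (c • fderiv ℝ W (c • y)) := by
    rw [smul_smul, inv_mul_cancel₀ hc, one_smul]
  rw [h5, h4, smul_smul]

/-- **The Laplacian off the origin is smooth** for a function smooth off the origin. -/
theorem contDiffAt_laplacian_of_contDiffOn (hΦ : ContDiffOn ℝ (⊤ : ℕ∞) Φ {0}ᶜ) {x : E3} (hx : x ≠ 0) :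
    ContDiffAt ℝ (⊤ : ℕ∞) (Δ Φ) x := by
  have hΦx : ContDiffAt ℝ (⊤ : ℕ∞) Φ x := (hΦ x hx).contDiffAt (isOpen_compl_singleton.mem_nhds hx)
  rw [InnerProductSpace.laplacian_eq_iteratedFDeriv_stdOrthonormalBasis]
  refine ContDiffAt.sum fun i _ => ?_
  have h2 : ContDiffAt ℝ (⊤ : ℕ∞) (iteratedFDeriv ℝ 2 Φ) x :=
    hΦx.iteratedFDeriv_right (m := (⊤ : ℕ∞)) (i := 2) (by exact le_of_eq (by norm_cast))
  exact (ContinuousMultilinearMap.apply ℝ (fun _ : Fin 2 => E3) ℝ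
    ![stdOrthonormalBasis ℝ E3 i, stdOrthonormalBasis ℝ E3 i]).contDiff.contDiffAt.comp x h2

/-- **Scaling law of the Laplacian of a degree-0 homogeneous function**: `ΔΦ(c y) = c⁻² ΔΦ(y)` (`y ≠ 0`, `c > 0`). -/
theorem laplacian_smul_of_zeroHomogeneous (hΦ : ContDiffOn ℝ (⊤ : ℕ∞) Φ {0}ᶜ)
    (hhom : ∀ c : ℝ, 0 < c → ∀ y : E3, Φ (c • y) = Φ y) {c : ℝ} (hc : 0 < c) {y : E3} (hy : y ≠ 0) :
    (Δ Φ) (c • y) = (c⁻¹ * c⁻¹) * (Δ Φ) y := by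
  have hopen : IsOpen ({0}ᶜ : Set E3) := isOpen_compl_singleton
  have hΦ2 : ∀ z : E3, z ≠ 0 → ContDiffAt ℝ 2 Φ z := fun z hz =>
    ((hΦ z hz).contDiffAt (hopen.mem_nhds hz)).of_le (by norm_cast)
  have hΦd : ∀ z : E3, z ≠ 0 → DifferentiableAt ℝ Φ z := fun z hz => (hΦ2 z hz).differentiableAt (by simp)
  have hgradΦC : ContDiffOn ℝ (⊤ : ℕ∞) (gradient Φ) {0}ᶜ :=
    (InnerProductSpace.toDual ℝ E3).symm.contDiff.comp_contDiffOn (hΦ.fderiv_of_isOpen hopen (by norm_cast))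
  have hgradΦd : ∀ z : E3, z ≠ 0 → DifferentiableAt ℝ (gradient Φ) z := fun z hz =>
    ((hgradΦC z hz).contDiffAt (hopen.mem_nhds hz)).differentiableAt (by simp)
  have hcy : c • y ≠ 0 := smul_ne_zero hc.ne' hy
  -- `∇Φ` is degree `−1` homogeneous near `y`
  have hgradhom : ∀ᶠ z in 𝓝 y, gradient Φ (c • z) = c⁻¹ • gradient Φ z := by
    filter_upwards [hopen.mem_nhds hy] with z hz
    exact SphereEuler.gradient_smul_of_zeroHomogeneous hc.ne' (hΦd z hz) (hΦd _ (smul_ne_zero hc.ne' hz))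
      (Eventually.of_forall fun w => hhom c hc w)
  rw [← divergence_gradient_eq_laplacian_of_contDiffAt (hΦ2 _ hcy), ← divergence_gradient_eq_laplacian_of_contDiffAt (hΦ2 y hy),
    VectorCalculus.divergence, VectorCalculus.divergence,
    fderiv_smul_of_invHomogeneous hc.ne' (hgradΦd y hy) (hgradΦd _ hcy) hgradhom, ContinuousLinearMap.toLinearMap_smul,
    map_smul, smul_eq_mul]

/-- ★ **STREAM-FUNCTION PROFILES.**  For `Φ` smooth off the origin and degree-0 homogeneous, the field
`U_Φ(z) = (−½‖z‖ΔΦ(z))·z + ‖z‖·∇Φ(z)` is smooth off the origin, degree-0 homogeneous, divergence free and unthreaded, has radial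
part `−½ r² ΔΦ`, and its order-one horizon law is the sphere bracket:
`𝔏₁[U_Φ](x) = −‖x‖ ⟪x, ∇(−½ r² ΔΦ)(x) × ∇Φ(x)⟫` for `x ≠ 0`. -/
theorem horizonL1_streamProfile (hΦ : ContDiffOn ℝ (⊤ : ℕ∞) Φ {0}ᶜ)
    (hhom : ∀ c : ℝ, 0 < c → ∀ y : E3, Φ (c • y) = Φ y) :
    (∀ c : ℝ, 0 < c → ∀ y : E3,
        (fun z : E3 => (-(1 / 2 : ℝ) * ‖z‖ * (Δ Φ) z) • z + ‖z‖ • gradient Φ z) (c • y)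
          = (fun z : E3 => (-(1 / 2 : ℝ) * ‖z‖ * (Δ Φ) z) • z + ‖z‖ • gradient Φ z) y) ∧
    (∀ x : E3, x ≠ 0 →
        VectorCalculus.divergence (fun z : E3 => (-(1 / 2 : ℝ) * ‖z‖ * (Δ Φ) z) • z + ‖z‖ • gradient Φ z) x = 0) ∧
    (∀ x : E3, x ≠ 0 →
        ⟪curl (fun z : E3 => (-(1 / 2 : ℝ) * ‖z‖ * (Δ Φ) z) • z + ‖z‖ • gradient Φ z) x, x⟫ = 0) ∧
    (∀ x : E3, x ≠ 0 →
        horizonL1 (fun z : E3 => (-(1 / 2 : ℝ) * ‖z‖ * (Δ Φ) z) • z + ‖z‖ • gradient Φ z) 0 x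
          = -‖x‖ * ⟪x, cross (gradient (fun z : E3 => -(1 / 2 : ℝ) * ‖z‖ ^ 2 * (Δ Φ) z) x) (gradient Φ x)⟫) := by
  have hopen : IsOpen ({0}ᶜ : Set E3) := isOpen_compl_singleton
  set g : E3 → ℝ := fun z => -(1 / 2 : ℝ) * ‖z‖ * (Δ Φ) z with hg
  set f : E3 → ℝ := fun z => -(1 / 2 : ℝ) * ‖z‖ ^ 2 * (Δ Φ) z with hf
  set U : E3 → E3 := fun z => g z • z + ‖z‖ • gradient Φ z with hU
  -- smoothness off the origin
  have hnormC : ContDiffOn ℝ (⊤ : ℕ∞) (fun w : E3 => ‖w‖) {0}ᶜ := fun z hz =>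
    (contDiffAt_norm ℝ (show z ≠ 0 from hz)).contDiffWithinAt
  have hΔC : ContDiffOn ℝ (⊤ : ℕ∞) (Δ Φ) {0}ᶜ := fun z hz =>
    (contDiffAt_laplacian_of_contDiffOn hΦ (show z ≠ 0 from hz)).contDiffWithinAt
  have hgC : ContDiffOn ℝ (⊤ : ℕ∞) g {0}ᶜ := (contDiffOn_const.mul hnormC).mul hΔC
  have hfC : ContDiffOn ℝ (⊤ : ℕ∞) f {0}ᶜ := (contDiffOn_const.mul (hnormC.pow 2)).mul hΔC
  have hgradΦC : ContDiffOn ℝ (⊤ : ℕ∞) (gradient Φ) {0}ᶜ :=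
    (InnerProductSpace.toDual ℝ E3).symm.contDiff.comp_contDiffOn (hΦ.fderiv_of_isOpen hopen (by norm_cast))
  have hUC : ContDiffOn ℝ (⊤ : ℕ∞) U {0}ᶜ := (hgC.smul contDiffOn_id).add (hnormC.smul hgradΦC)
  -- pointwise regularity off the origin
  have hΦ2 : ∀ z : E3, z ≠ 0 → ContDiffAt ℝ 2 Φ z := fun z hz =>
    ((hΦ z hz).contDiffAt (hopen.mem_nhds hz)).of_le (by norm_cast)
  have hΦd : ∀ z : E3, z ≠ 0 → DifferentiableAt ℝ Φ z := fun z hz => (hΦ2 z hz).differentiableAt (by simp)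
  have hgd : ∀ z : E3, z ≠ 0 → DifferentiableAt ℝ g z := fun z hz =>
    ((hgC z hz).contDiffAt (hopen.mem_nhds hz)).differentiableAt (by simp)
  have hgradΦd : ∀ z : E3, z ≠ 0 → DifferentiableAt ℝ (gradient Φ) z := fun z hz =>
    ((hgradΦC z hz).contDiffAt (hopen.mem_nhds hz)).differentiableAt (by simp)
  -- homogeneity of the ingredients
  have hΔhom : ∀ c : ℝ, 0 < c → ∀ y : E3, y ≠ 0 → (Δ Φ) (c • y) = (c⁻¹ * c⁻¹) * (Δ Φ) y :=
    fun c hc y hy => laplacian_smul_of_zeroHomogeneous hΦ hhom hc hy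
  have hghom : ∀ c : ℝ, 0 < c → ∀ y : E3, y ≠ 0 → g (c • y) = c⁻¹ * g y := by
    intro c hc y hy
    simp only [hg, hΔhom c hc y hy, norm_smul, Real.norm_of_nonneg hc.le]
    field_simp
  have hfhom : ∀ c : ℝ, 0 < c → ∀ y : E3, y ≠ 0 → f (c • y) = f y := by
    intro c hc y hy
    simp only [hf, hΔhom c hc y hy, norm_smul, Real.norm_of_nonneg hc.le]
    field_simp
  have hgradΦhom : ∀ c : ℝ, 0 < c → ∀ y : E3, y ≠ 0 → gradient Φ (c • y) = c⁻¹ • gradient Φ y := by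
    intro c hc y hy
    exact SphereEuler.gradient_smul_of_zeroHomogeneous hc.ne' (hΦd y hy) (hΦd _ (smul_ne_zero hc.ne' hy))
      (Eventually.of_forall fun z => hhom c hc z)
  -- (1) degree-0 homogeneity of `U`
  have hUhom : ∀ c : ℝ, 0 < c → ∀ y : E3, U (c • y) = U y := by
    intro c hc y
    by_cases hy : y = 0
    · rw [hy, smul_zero]
    · show g (c • y) • (c • y) + ‖c • y‖ • gradient Φ (c • y) = g y • y + ‖y‖ • gradient Φ y
      rw [hghom c hc y hy, hgradΦhom c hc y hy, norm_smul, Real.norm_of_nonneg hc.le, smul_smul, smul_smul]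
      have e1 : c⁻¹ * g y * c = g y := by field_simp
      have e2 : c * ‖y‖ * c⁻¹ = ‖y‖ := by field_simp
      rw [e1, e2]
  -- Euler identities
  have hEulerΦ : ∀ z : E3, z ≠ 0 → ⟪gradient Φ z, z⟫ = 0 := by
    intro z hz
    have hev : ∀ᶠ c in 𝓝 (1 : ℝ), Φ (c • z) = (fun _ : ℝ => (1 : ℝ)) c • Φ z := by
      filter_upwards [Ioi_mem_nhds (zero_lt_one' ℝ)] with c hc
      rw [hhom c hc z, one_smul]
    have h := PoloidalField.fderiv_apply_self_of_homogeneous (a := fun _ : ℝ => (1 : ℝ)) (a' := 0) (hΦd z hz)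
      (hasDerivAt_const (1 : ℝ) (1 : ℝ)) hev
    rw [Literature.Analysis.FluidPDE.inner_gradient_left, h, zero_smul]
  have hEulerg : ∀ z : E3, z ≠ 0 → fderiv ℝ g z z = -g z := by
    intro z hz
    have hev : ∀ᶠ c in 𝓝 (1 : ℝ), g (c • z) = (fun c : ℝ => c⁻¹) c • g z := by
      filter_upwards [Ioi_mem_nhds (zero_lt_one' ℝ)] with c hc
      rw [hghom c hc z hz, smul_eq_mul]
    have ha : HasDerivAt (fun c : ℝ => c⁻¹) (-1 : ℝ) 1 := by
      simpa using (hasDerivAt_inv (one_ne_zero' ℝ))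
    have h := PoloidalField.fderiv_apply_self_of_homogeneous (a := fun c : ℝ => c⁻¹) (a' := -1) (hgd z hz) ha hev
    rw [h, smul_eq_mul, neg_one_mul]
  -- (2) divergence free off the origin
  have hUdiv : ∀ z : E3, z ≠ 0 → VectorCalculus.divergence U z = 0 := by
    intro z hz
    have hnz : ‖z‖ ≠ 0 := norm_ne_zero_iff.mpr hz
    have hd1 : DifferentiableAt ℝ (fun w : E3 => g w • w) z := (hgd z hz).smul differentiableAt_id
    have hd2 : DifferentiableAt ℝ (fun w : E3 => ‖w‖ • gradient Φ w) z :=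
      (SphereEuler.differentiableAt_norm' hz).smul (hgradΦd z hz)
    have hadd : VectorCalculus.divergence U z = VectorCalculus.divergence (fun w : E3 => g w • w) z
        + VectorCalculus.divergence (fun w : E3 => ‖w‖ • gradient Φ w) z := by
      simp only [VectorCalculus.divergence, hU]
      rw [fderiv_fun_add hd1 hd2, ContinuousLinearMap.toLinearMap_add, map_add]
    have hdivA : VectorCalculus.divergence (fun w : E3 => g w • w) z = 2 * g z := by
      rw [divergence_smul_apply (u := fun w : E3 => w) (hgd z hz) differentiableAt_id, hEulerg z hz,
        Sverak2011.divergence_id_three]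
      ring
    have hdivB : VectorCalculus.divergence (fun w : E3 => ‖w‖ • gradient Φ w) z = ‖z‖ * (Δ Φ) z := by
      rw [divergence_smul_apply (SphereEuler.differentiableAt_norm' hz) (hgradΦd z hz),
        divergence_gradient_eq_laplacian_of_contDiffAt (hΦ2 z hz), SphereEuler.fderiv_norm_apply hz, real_inner_comm,
        hEulerΦ z hz, mul_zero, add_zero]
    rw [hadd, hdivA, hdivB]
    simp only [hg]
    ring
  -- (3) unthreaded off the origin
  have hUrot : ∀ z : E3, z ≠ 0 → ⟪curl U z, z⟫ = 0 := by
    intro z hz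
    have hd1 : DifferentiableAt ℝ (fun w : E3 => g w • w) z := (hgd z hz).smul differentiableAt_id
    have hd2 : DifferentiableAt ℝ (fun w : E3 => ‖w‖ • gradient Φ w) z :=
      (SphereEuler.differentiableAt_norm' hz).smul (hgradΦd z hz)
    have hcurl : curl U z = curl (fun w : E3 => g w • w) z + curl (fun w : E3 => ‖w‖ • gradient Φ w) z := by
      rw [hU, curl_add hd1 hd2]
    have hsl : cross (‖z‖⁻¹ • z) (gradient Φ z) = ‖z‖⁻¹ • cross z (gradient Φ z) := by
      rw [← crossCLM_apply, ← crossCLM_apply, map_smul]; rfl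
    rw [hcurl, PoloidalField.curl_smul_self (hgd z hz),
      OrderTwo.curl_smul_gradient (SphereEuler.differentiableAt_norm' hz) (hΦ2 z hz), SphereEuler.gradient_norm hz,
      inner_add_left, Tao2016.inner_cross_self_right, hsl, real_inner_smul_left, Tao2016.inner_cross_self_left]
    ring
  -- (4) the radial part and the potential equation
  have hUf : ∀ z : E3, z ≠ 0 → f z = ⟪U z, z - 0⟫ / ‖z - 0‖ := by
    intro z hz
    have hnz : ‖z‖ ≠ 0 := norm_ne_zero_iff.mpr hz
    rw [sub_zero, hU]
    simp only [hf, hg]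
    rw [inner_add_left, real_inner_smul_left, real_inner_smul_left, real_inner_self_eq_norm_sq, hEulerΦ z hz, mul_zero,
      add_zero]
    field_simp
  have hUP : ∀ z : E3, z ≠ 0 → ‖z - 0‖ ^ 2 * (Δ Φ) z = -2 * f z := by
    intro z hz
    rw [sub_zero]
    simp only [hf]
    ring
  refine ⟨hUhom, hUdiv, hUrot, fun x hx => ?_⟩
  -- (5) the order-one law from `OrderOneSphereEuler`
  have h1 : ContDiffOn ℝ (⊤ : ℕ∞) U {(0 : E3)}ᶜ := hUC
  have h3 : IsZeroHomogeneousAbout 0 U := fun c hc y => by rw [zero_add, zero_add]; exact hUhom c hc y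
  have h4 : ∀ c : ℝ, 0 < c → ∀ y : E3, Φ (0 + c • y) = Φ (0 + y) := fun c hc y => by
    rw [zero_add, zero_add]; exact hhom c hc y
  have h6 : ∀ z : E3, z ≠ 0 → ⟪curl U z, z - 0⟫ = 0 := fun z hz => by rw [sub_zero]; exact hUrot z hz
  have hSE := orderOneSphereEuler U f Φ 0 h1 hΦ h3 h4 hUdiv h6 hUf hUP x hx
  rw [sub_zero] at hSE
  exact hSE

end StreamProfile

end Summit.NavierStokesRegularity.NavierStokesRegularity.Theorems.PoloidalLiouville.HorizonTower

end
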